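import Summits.CriticalPhenomena.CardyFormulaZ2.Theorems.CardyIKTransportIKLinearTransportStubCoalescingRowKernelReroute
import Summits.CriticalPhenomena.CardyFormulaZ2.Theorems.CardyIKTransportIKLinearTransportStubCoalescingRowKernelTail

/-!
# Stub `stub_CutMarkovLocal` (Loc) — part A: the strip diagram BETWEEN TWO CERTIFIED CUT ROWS is local

Support file (`--supports stmt-CriticalPhenomena-5076`, registered sub-goal `stripDiagram_agree_between_certs`).

The combinatorial half of the locality (Loc) of the cut-Markov heat bath (`…StubCoalescingRowKernelReduction.lean`):
if two configurations `x, x'` agree on the strip cells and faces (cell columns `i, i+1, i+2`) of the rows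
`c-2, …, c'+2`, and `x` carries the local cut certificates `IsCutCert i c x`, `IsCutCert i c' x` (hence so does
`x'`), then their strip diagrams agree on every pair of boundary cells with rows in `[c, c']`:
a monochromatic strip path of `x` between two such cells is rerouted (TWO-SIDED rerouting, `crk_reroute_twoSided`:
the upper-side rerouting at the cut `c` of `isCut_reroute`, then the abstract lower-side rerouting at `c'` inside
the half strip `{c ≤ row}`, the separation at row `c'` holding in any part of the strip, `crk_rowc_sep`) to stay in
the rows `[c, c']`, where the two triangulations and colourings coincide (`crk_cellGraph_adj_congr`: an edge of the
triangulation between strip cells reads only the flags of the faces it spans). Hence the WINDOW strip diagram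
(computed from the configuration restricted to a window containing these rows) and the GLOBAL strip diagram agree
on the pairs between two certified cuts — the input of the environment-locality of a two-sided cut-Markov kernel.
-/

noncomputable section

namespace Summit.CriticalPhenomena.CardyFormulaZ2.Theorems.IKLinearTransport.PinnedDiagramExchange

open scoped Classical MeasureTheory ENNReal symmDiff
open Set MeasureTheory
open Literature.Probability.Percolation Literature.Probability.LatticeModels

/-! ## From the diagram to reachability inside the strip set, and two-sided rerouting -/

/-- A diagram pair is a pair of boundary cells joined inside the monochromatic strip set of the colour of its
first cell. [folklore] -/
theorem crk_within_of_mem_stripDiagram (i : ℤ) (x : Obs) {P Q : Site 2} (h : (P, Q) ∈ stripDiagram i x) :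
    P ∈ crkStrip i x (P ∈ x.1) ∧ Q ∈ crkStrip i x (P ∈ x.1) ∧ (P 0 = i ∨ P 0 = i + 2) ∧ (Q 0 = i ∨ Q 0 = i + 2) ∧
      (SDE.within (cellGraph x.2) (crkStrip i x (P ∈ x.1))).Reachable P Q := by
  obtain ⟨hP0, hQ0, hQ, hP, hreach⟩ := h
  have hP' : P ∈ crkStrip i x (P ∈ x.1) := ⟨Iff.rfl, hP⟩
  exact ⟨hP', hQ, hP0, hQ0, (SDE.induce_reachable_iff (cellGraph x.2) (crkStrip i x (P ∈ x.1)) hP' hQ).1 hreach⟩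

/-- TWO-SIDED REROUTING: between two cut rows `c ≤ c'` of the pinned statistic of `x`, two strip cells of one colour
with rows in `[c, c']` joined by a monochromatic strip path are joined by one staying in the rows `[c, c']`. [folklore] -/
theorem crk_reroute_twoSided (i c c' : ℤ) (x : Obs) (hc : IsCut i c (pinnedStat i x)) (hc' : IsCut i c' (pinnedStat i x))
    (κ : Prop) {P Q : Site 2} (hP : P ∈ crkStrip i x κ) (hQ : Q ∈ crkStrip i x κ)
    (hPc : c ≤ P 1) (hPc' : P 1 ≤ c') (hQc : c ≤ Q 1) (hQc' : Q 1 ≤ c')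
    (h : (SDE.within (cellGraph x.2) (crkStrip i x κ)).Reachable P Q) :
    (SDE.within (cellGraph x.2) (crkStrip i x κ ∩ {v | c ≤ v 1} ∩ {v | v 1 ≤ c'})).Reachable P Q := by
  have h1 := (isCut_reroute i c x hc κ P Q hP hQ h).1 hPc hQc
  have hG : ∀ u v : Site 2, (cellGraph x.2).Adj u v → v 1 ≤ u 1 + 1 ∧ u 1 ≤ v 1 + 1 := fun u v huv =>
    ⟨(crk_adj_near huv).1, (crk_adj_near huv).2.1⟩
  exact crk_reroute_abstract_lower (cellGraph x.2) (fun v => v 1) hG (crkStrip i x κ ∩ {v | c ≤ v 1}) c'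
    (fun X Y hX hY hXc hYc hr => crk_rowc_sep i c' x hc' κ (t := crkStrip i x κ ∩ {v | c ≤ v 1} ∩ {v | c' ≤ v 1})
      (fun v hv => hv.1.1) X Y hX.1 hY.1 hXc hYc hr)
    ⟨⟨hP, hPc⟩, hPc'⟩ ⟨⟨hQ, hQc⟩, hQc'⟩ h1

/-! ## The triangulation between strip cells reads only nearby flags -/

/-- An edge of the random triangulation between two cells of the columns `[i, i+2]` and rows `[lo, hi]` reads only
the flags of the faces of the columns `[i, i+2]` and rows `[lo - 1, hi]`. [folklore] -/
theorem crk_cellGraph_adj_congr (A A' : Set (Site 2)) (i lo hi : ℤ)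
    (hA : ∀ f : Site 2, i ≤ f 0 → f 0 ≤ i + 2 → lo - 1 ≤ f 1 → f 1 ≤ hi → (f ∈ A ↔ f ∈ A'))
    {u v : Site 2} (hu : i ≤ u 0 ∧ u 0 ≤ i + 2 ∧ lo ≤ u 1 ∧ u 1 ≤ hi) (hv : i ≤ v 0 ∧ v 0 ≤ i + 2 ∧ lo ≤ v 1 ∧ v 1 ≤ hi) :
    (cellGraph A).Adj u v ↔ (cellGraph A').Adj u v := by
  rw [SDE.cellGraph_adj_iff, SDE.cellGraph_adj_iff]
  have key := SDE.grid_adj_map (fun c d => (![c, d] : Site 2) ∈ A) (fun c d => (![c, d] : Site 2) ∈ A') 0 0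
    (u 0, u 1) (v 0, v 1) (fun c d hc hd => by
      rw [add_zero, add_zero]
      exact hA ![c, d] (by simp only [Matrix.cons_val_zero]; omega)
        (by simp only [Matrix.cons_val_zero]; omega) (by simp only [Matrix.cons_val_one, Matrix.cons_val_fin_one]; omega)
        (by simp only [Matrix.cons_val_one, Matrix.cons_val_fin_one]; omega))
  simpa only [add_zero] using key

/-! ## The strip diagram between two certified cuts is local -/

/-- One direction of the locality, for a pair written as two cells. [folklore] -/
theorem crk_stripDiagram_imp_of_certs (i c c' : ℤ) (x x' : Obs)
    (hagree : ∀ w : Site 2, i ≤ w 0 → w 0 ≤ i + 2 → c - 2 ≤ w 1 → w 1 ≤ c' + 2 →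
      (w ∈ x.1 ↔ w ∈ x'.1) ∧ (w ∈ x.2 ↔ w ∈ x'.2))
    (hc : IsCutCert i c x) (hc' : IsCutCert i c' x) {P Q : Site 2}
    (h1 : c ≤ P 1) (h2 : P 1 ≤ c') (h3 : c ≤ Q 1) (h4 : Q 1 ≤ c') (h : (P, Q) ∈ stripDiagram i x) :
    (P, Q) ∈ stripDiagram i x' := by
  obtain ⟨hP, hQ, hP0, hQ0, hreach⟩ := crk_within_of_mem_stripDiagram i x h
  have hcut := isCut_pinnedStat_of_cert i c x hc
  have hcut' := isCut_pinnedStat_of_cert i c' x hc'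
  set κ : Prop := P ∈ x.1 with hκ
  set s : Set (Site 2) := crkStrip i x κ ∩ {v | c ≤ v 1} ∩ {v | v 1 ≤ c'} with hs
  have hin : (SDE.within (cellGraph x.2) s).Reachable P Q :=
    crk_reroute_twoSided i c c' x hcut hcut' κ hP hQ h1 h2 h3 h4 hreach
  -- the same path in the triangulation of `x'`
  have hin' : (SDE.within (cellGraph x'.2) s).Reachable P Q := by
    refine SDE.within_mono_graph s (fun u v hu hv huv => ?_) hin
    refine (crk_cellGraph_adj_congr x.2 x'.2 i c c' (fun f hf1 hf2 hf3 hf4 => (hagree f hf1 hf2 (by omega) (by omega)).2)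
      ⟨hu.1.1.2.1, hu.1.1.2.2, hu.1.2, hu.2⟩ ⟨hv.1.1.2.1, hv.1.1.2.2, hv.1.2, hv.2⟩).1 huv
  -- colours agree on `s`, so `s` sits inside the strip set of `x'`
  have hκ' : κ ↔ P ∈ x'.1 := (hagree P hP.2.1 hP.2.2 (by omega) (by omega)).1
  have hsub : s ⊆ crkStrip i x' (P ∈ x'.1) := by
    intro v hv
    have hv1 := (hagree v hv.1.1.2.1 hv.1.1.2.2 (by have := hv.1.2; simp only [mem_setOf_eq] at this; omega)
      (by have := hv.2; simp only [mem_setOf_eq] at this; omega)).1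
    exact ⟨(hv1.symm.trans hv.1.1.1).trans hκ', hv.1.1.2.1, hv.1.1.2.2⟩
  have hP' : P ∈ crkStrip i x' (P ∈ x'.1) := ⟨Iff.rfl, hP.2.1, hP.2.2⟩
  have hQ' : Q ∈ crkStrip i x' (P ∈ x'.1) := hsub ⟨⟨hQ, hQc_aux⟩, h4⟩
  exact crk_mem_stripDiagram_of_within i x' (P ∈ x'.1) hP0 hQ0 hP' hQ' hsub hin'
  where hQc_aux : Q ∈ {v : Site 2 | c ≤ v 1} := h3

/-- Local cut certificates transfer along the agreement of the strip cells of the rows `c-2, …, c'+2`. [folklore] -/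
theorem crk_certs_congr (i c c' : ℤ) (x x' : Obs)
    (hagree : ∀ w : Site 2, i ≤ w 0 → w 0 ≤ i + 2 → c - 2 ≤ w 1 → w 1 ≤ c' + 2 →
      (w ∈ x.1 ↔ w ∈ x'.1) ∧ (w ∈ x.2 ↔ w ∈ x'.2)) (hcc' : c ≤ c') :
    (IsCutCert i c x ↔ IsCutCert i c x') ∧ (IsCutCert i c' x ↔ IsCutCert i c' x') :=
  ⟨isCutCert_congr i c x x' fun v h1 h2 h3 h4 => (hagree v h1 h2 h3 (by omega)).1,
    isCutCert_congr i c' x x' fun v h1 h2 h3 h4 => (hagree v h1 h2 (by omega) h4).1⟩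

/-- THE STRIP DIAGRAM BETWEEN TWO CERTIFIED CUT ROWS IS LOCAL (registered sub-goal): if `x, x'` agree on the strip
cells and faces of the rows `c-2, …, c'+2` and `x` certifies cut rows at `c ≤ c'`, the two strip diagrams agree on
every pair of boundary cells with rows in `[c, c']`. [folklore] -/
theorem stripDiagram_agree_between_certs : ∀ (i c c' : ℤ) (x x' : Obs),
    (∀ w : Site 2, i ≤ w 0 → w 0 ≤ i + 2 → c - 2 ≤ w 1 → w 1 ≤ c' + 2 → (w ∈ x.1 ↔ w ∈ x'.1) ∧ (w ∈ x.2 ↔ w ∈ x'.2)) →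
    IsCutCert i c x → IsCutCert i c' x → c ≤ c' → ∀ q : Site 2 × Site 2,
    c ≤ q.1 1 → q.1 1 ≤ c' → c ≤ q.2 1 → q.2 1 ≤ c' → (q ∈ stripDiagram i x ↔ q ∈ stripDiagram i x') := by
  intro i c c' x x' hagree hc hc' hcc' q h1 h2 h3 h4
  have hagree' : ∀ w : Site 2, i ≤ w 0 → w 0 ≤ i + 2 → c - 2 ≤ w 1 → w 1 ≤ c' + 2 →
      (w ∈ x'.1 ↔ w ∈ x.1) ∧ (w ∈ x'.2 ↔ w ∈ x.2) := fun w a b d e =>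
    ⟨(hagree w a b d e).1.symm, (hagree w a b d e).2.symm⟩
  obtain ⟨ec, ec'⟩ := crk_certs_congr i c c' x x' hagree hcc'
  obtain ⟨P, Q⟩ := q
  exact ⟨crk_stripDiagram_imp_of_certs i c c' x x' hagree hc hc' h1 h2 h3 h4,
    crk_stripDiagram_imp_of_certs i c c' x' x hagree' (ec.1 hc) (ec'.1 hc') h1 h2 h3 h4⟩

end Summit.CriticalPhenomena.CardyFormulaZ2.Theorems.IKLinearTransport.PinnedDiagramExchange
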